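import Summits.QuantumFields.YangMills.Theorems.AllWindowsColdBoxBoxHighLineErrorBudget

/-!
# T-S5.13 final bookkeeping, part 1 — the ε₂ LARGENESS CONDITIONS at the v13 point (pure real arithmetic)
# (LEAD ym-line-sfw-p2 g77 GO 2026-08-29T21:36:42Z «w3 = hands for the v13 final bookkeeping»; ASSEMBLY-S5 §6/§7/§8, `g77-ASSEMBLY-E2-memo.md`;
# LINE-19 S5 ⟨stmt-QuantumFields-24004⟩/⟨24335⟩)

Width seat `ym-line-sfw-p2-w3` (g40).  No measure theory here: only the «∃ β₀, ∀ β ≥ β₀, ∀ H ≤ β^θ + 1» monomial budgets that the ε₂-half of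
`landauRelativeComparisonBulk_of_split` consumes, at the v13 parameter point `κ₃ = (1 + 16θ)/36`, `s = β^{κ₃ − 1/2}`, `0 < θ < 5/64`:

* `budget_monomial` — `C·H^k·(1+log H)^m·s^j·β^a ≤ ε` eventually if `kθ + a < j(1/2 − κ₃)` (✓`ErrorBudget.exists_forall_natPow_log_le`), and its
  four weight shapes `budget_one/inv/sqrt/invSqrt` (`w = 1, 1/β, √β, 1/√β`);
* `k3_expr_le` — the algebra of fcl-p3 g26's K3 bound (`abs_tiltCum3_muD_zero_chartPlaqCost_le_sizes`): `β²·H⁸·(T₁+T₂+T₃+T₄) ≤` twelve monomials,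
  by `√(a_E a_O) ≤ (s·a_E + a_O/s)/2` and `√(C_U L^m) ≤ √C_U·L^m`; `k3_budget` — all twelve are `≤ ε` eventually for `θ < 5/64`;
* `k4_budget` — w5 g23's K4 bound (`abs_tiltCum4_muD_le_rpow`) times `β²H⁸/2`: `H¹²/β`, `H¹⁶β^{4κ₃−2}`, `H²⁰β^{10κ₃−3}`;
* `f0_budget` — 13f₀'s `96τβ² + C/β` with `τ ≤ C₆H⁴e^{−cβs²}` times `H⁸`;
* `side_budget` — `H⁴ ≤ β`, `s·H² ≤ c`, `252·s < 1/4/H²`, `X ≤ H`, `s ≤ 1`, `1 ≤ K·β^δ`.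

HONEST LABEL: arithmetic for the OPEN assembly T-S5.13 of the XL stub S5 of a critic-PASSed DRAFT line; S5, U5, ⟨24004⟩ ⟨24335⟩ ⟨24336⟩ remain OPEN;
no crux, rung or summit is proved; **the Yang–Mills mass gap is NOT proved by this file.**
-/

set_option autoImplicit false

noncomputable section

namespace Summit.QuantumFields.YangMills.Theorems.AllWindowsColdBoxBoxHighLine

namespace AssemblyBudget

open ErrorBudget

/-! ## Generic monomial budgets -/

/-- `(β^x)^n = β^(x·n)`. -/
theorem rpow_pow_eq {β : ℝ} (hβ : 0 ≤ β) (x : ℝ) (n : ℕ) : (β ^ x) ^ n = β ^ (x * n) := by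
  rw [Real.rpow_mul hβ, Real.rpow_natCast]

/-- **Monomial budget**: if `kθ + a < j(1/2 − κ₃)` then `C·H^k·(1+log H)^m·(β^{κ₃−1/2})^j·β^a ≤ ε` for `β ≥ β₀`, `1 ≤ H ≤ β^θ + 1`. -/
theorem budget_monomial {θ κ₃ a ε : ℝ} {k j : ℕ} (hθ : 0 ≤ θ) (hcond : (k : ℝ) * θ + a < (j : ℝ) * (1 / 2 - κ₃)) (hε : 0 < ε)
    (C : ℝ) (m : ℕ) :
    ∃ β₀ : ℝ, 1 ≤ β₀ ∧ ∀ β : ℝ, β₀ ≤ β → ∀ H : ℕ, 1 ≤ H → (H : ℝ) ≤ β ^ θ + 1 →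
      C * (H : ℝ) ^ k * (1 + Real.log H) ^ m * (β ^ (κ₃ - 1 / 2)) ^ j * β ^ a ≤ ε := by
  obtain ⟨β₀, hβ₀, h⟩ := exists_forall_natPow_log_le (k := k) (γ := (j : ℝ) * (1 / 2 - κ₃) - a) hθ (by linarith) hε C m 0
  refine ⟨β₀, hβ₀, fun β hβ H hH hHβ => ?_⟩
  have hβpos : 0 < β := by linarith
  have h1 := h β hβ H hH hHβ
  rw [pow_zero, mul_one] at h1
  have hid : (β ^ (κ₃ - 1 / 2)) ^ j * β ^ a = 1 / β ^ ((j : ℝ) * (1 / 2 - κ₃) - a) := by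
    rw [rpow_pow_eq hβpos.le, ← Real.rpow_add hβpos, eq_div_iff (Real.rpow_pos_of_pos hβpos _).ne', ← Real.rpow_add hβpos,
      show (κ₃ - 1 / 2) * (j : ℝ) + a + ((j : ℝ) * (1 / 2 - κ₃) - a) = 0 by ring, Real.rpow_zero]
  calc C * (H : ℝ) ^ k * (1 + Real.log H) ^ m * (β ^ (κ₃ - 1 / 2)) ^ j * β ^ a
      = C * (H : ℝ) ^ k * (1 + Real.log H) ^ m * ((β ^ (κ₃ - 1 / 2)) ^ j * β ^ a) := by ring
    _ = C * (H : ℝ) ^ k * (1 + Real.log H) ^ m / β ^ ((j : ℝ) * (1 / 2 - κ₃) - a) := by rw [hid]; ring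
    _ ≤ ε := h1

/-- Weight `1`: `C·H^k·L^m·s^j ≤ ε` eventually iff `kθ < j(1/2 − κ₃)`. -/
theorem budget_one {θ κ₃ ε : ℝ} {k j : ℕ} (hθ : 0 ≤ θ) (hcond : (k : ℝ) * θ < (j : ℝ) * (1 / 2 - κ₃)) (hε : 0 < ε) (C : ℝ) (m : ℕ) :
    ∃ β₀ : ℝ, 1 ≤ β₀ ∧ ∀ β : ℝ, β₀ ≤ β → ∀ H : ℕ, 1 ≤ H → (H : ℝ) ≤ β ^ θ + 1 →
      C * (H : ℝ) ^ k * (1 + Real.log H) ^ m * (β ^ (κ₃ - 1 / 2)) ^ j ≤ ε := by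
  obtain ⟨β₀, hβ₀, h⟩ := budget_monomial (a := 0) (k := k) (j := j) (κ₃ := κ₃) hθ (by linarith) hε C m
  refine ⟨β₀, hβ₀, fun β hβ H hH hHβ => ?_⟩
  have h1 := h β hβ H hH hHβ
  rwa [Real.rpow_zero, mul_one] at h1

/-- Weight `1/β`: `C·H^k·L^m·s^j/β ≤ ε` eventually iff `kθ − 1 < j(1/2 − κ₃)`. -/
theorem budget_inv {θ κ₃ ε : ℝ} {k j : ℕ} (hθ : 0 ≤ θ) (hcond : (k : ℝ) * θ - 1 < (j : ℝ) * (1 / 2 - κ₃)) (hε : 0 < ε) (C : ℝ) (m : ℕ) :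
    ∃ β₀ : ℝ, 1 ≤ β₀ ∧ ∀ β : ℝ, β₀ ≤ β → ∀ H : ℕ, 1 ≤ H → (H : ℝ) ≤ β ^ θ + 1 →
      C * (H : ℝ) ^ k * (1 + Real.log H) ^ m * (β ^ (κ₃ - 1 / 2)) ^ j / β ≤ ε := by
  obtain ⟨β₀, hβ₀, h⟩ := budget_monomial (a := -1) (k := k) (j := j) (κ₃ := κ₃) hθ (by linarith) hε C m
  refine ⟨β₀, hβ₀, fun β hβ H hH hHβ => ?_⟩
  have hβpos : 0 < β := by linarith
  have h1 := h β hβ H hH hHβ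
  rwa [Real.rpow_neg_one, ← div_eq_mul_inv] at h1

/-- Weight `√β`: `C·H^k·L^m·s^j·√β ≤ ε` eventually iff `kθ + 1/2 < j(1/2 − κ₃)`. -/
theorem budget_sqrt {θ κ₃ ε : ℝ} {k j : ℕ} (hθ : 0 ≤ θ) (hcond : (k : ℝ) * θ + 1 / 2 < (j : ℝ) * (1 / 2 - κ₃)) (hε : 0 < ε) (C : ℝ) (m : ℕ) :
    ∃ β₀ : ℝ, 1 ≤ β₀ ∧ ∀ β : ℝ, β₀ ≤ β → ∀ H : ℕ, 1 ≤ H → (H : ℝ) ≤ β ^ θ + 1 →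
      C * (H : ℝ) ^ k * (1 + Real.log H) ^ m * (β ^ (κ₃ - 1 / 2)) ^ j * Real.sqrt β ≤ ε := by
  obtain ⟨β₀, hβ₀, h⟩ := budget_monomial (a := 1 / 2) (k := k) (j := j) (κ₃ := κ₃) hθ (by linarith) hε C m
  refine ⟨β₀, hβ₀, fun β hβ H hH hHβ => ?_⟩
  have hβpos : 0 < β := by linarith
  have h1 := h β hβ H hH hHβ
  rwa [← Real.sqrt_eq_rpow] at h1

/-- Weight `1/√β`: `C·H^k·L^m·s^j/√β ≤ ε` eventually iff `kθ − 1/2 < j(1/2 − κ₃)`. -/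
theorem budget_invSqrt {θ κ₃ ε : ℝ} {k j : ℕ} (hθ : 0 ≤ θ) (hcond : (k : ℝ) * θ - 1 / 2 < (j : ℝ) * (1 / 2 - κ₃)) (hε : 0 < ε) (C : ℝ)
    (m : ℕ) :
    ∃ β₀ : ℝ, 1 ≤ β₀ ∧ ∀ β : ℝ, β₀ ≤ β → ∀ H : ℕ, 1 ≤ H → (H : ℝ) ≤ β ^ θ + 1 →
      C * (H : ℝ) ^ k * (1 + Real.log H) ^ m * (β ^ (κ₃ - 1 / 2)) ^ j / Real.sqrt β ≤ ε := by
  obtain ⟨β₀, hβ₀, h⟩ := budget_monomial (a := -(1 / 2)) (k := k) (j := j) (κ₃ := κ₃) hθ (by linarith) hε C m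
  refine ⟨β₀, hβ₀, fun β hβ H hH hHβ => ?_⟩
  have hβpos : 0 < β := by linarith
  have h1 := h β hβ H hH hHβ
  rwa [Real.rpow_neg hβpos.le, ← Real.sqrt_eq_rpow, ← div_eq_mul_inv] at h1

/-! ## Side conditions -/

/-- `X ≤ β^θ` eventually (`θ > 0`). -/
theorem exists_beta0_le_rpow {θ : ℝ} (hθ : 0 < θ) (X : ℝ) : ∃ β₀ : ℝ, 1 ≤ β₀ ∧ ∀ β : ℝ, β₀ ≤ β → X ≤ β ^ θ := by
  set X' : ℝ := max X 1 with hX'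
  have hX'1 : 1 ≤ X' := le_max_right _ _
  have hX'0 : 0 ≤ X' := by linarith
  refine ⟨X' ^ (1 / θ), Real.one_le_rpow hX'1 (by positivity), fun β hβ => ?_⟩
  have hb0 : 0 ≤ X' ^ (1 / θ) := Real.rpow_nonneg hX'0 _
  calc X ≤ X' := le_max_left _ _
    _ = (X' ^ (1 / θ)) ^ θ := by rw [← Real.rpow_mul hX'0, one_div_mul_cancel hθ.ne', Real.rpow_one]
    _ ≤ β ^ θ := Real.rpow_le_rpow hb0 hβ hθ.le

/-- `1 ≤ K·β^δ` eventually (`K, δ > 0`). -/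
theorem exists_beta0_one_le_mul_rpow {K δ : ℝ} (hK : 0 < K) (hδ : 0 < δ) : ∃ β₀ : ℝ, 1 ≤ β₀ ∧ ∀ β : ℝ, β₀ ≤ β → 1 ≤ K * β ^ δ := by
  obtain ⟨β₀, hβ₀, h⟩ := exists_beta0_le_rpow hδ (1 / K)
  refine ⟨β₀, hβ₀, fun β hβ => ?_⟩
  have h1 := h β hβ
  rw [div_le_iff₀ hK] at h1
  linarith [mul_comm (β ^ δ) K]

/-- **Side budget**: for `0 < θ`, `4θ < 1`, `2θ < 1/2 − κ₃`, `c > 0`, `X`: eventually (with `s = β^{κ₃−1/2}`, `β^θ ≤ H ≤ β^θ + 1`)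
`H⁴ ≤ β`, `s·H² ≤ c`, `252·s < 1/4/H²`, `X ≤ H` and `s ≤ 1`. -/
theorem side_budget {θ κ₃ c : ℝ} (hθ : 0 < θ) (h4 : 4 * θ < 1) (h2 : 2 * θ < 1 / 2 - κ₃) (hc : 0 < c) (X : ℝ) :
    ∃ β₀ : ℝ, 1 ≤ β₀ ∧ ∀ β : ℝ, β₀ ≤ β → ∀ H : ℕ, 1 ≤ H → β ^ θ ≤ (H : ℝ) → (H : ℝ) ≤ β ^ θ + 1 →
      (H : ℝ) ^ 4 ≤ β ∧ β ^ (κ₃ - 1 / 2) * (H : ℝ) ^ 2 ≤ c ∧ 252 * β ^ (κ₃ - 1 / 2) < 1 / 4 / (H : ℝ) ^ 2 ∧ X ≤ (H : ℝ) ∧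
        β ^ (κ₃ - 1 / 2) ≤ 1 := by
  have hθ0 : 0 ≤ θ := hθ.le
  obtain ⟨b₁, hb₁, h₁⟩ := budget_inv (k := 4) (j := 0) (κ₃ := κ₃) hθ0 (by push_cast; linarith) one_pos 1 0
  obtain ⟨b₂, hb₂, h₂⟩ := budget_one (k := 2) (j := 1) (κ₃ := κ₃) hθ0 (by push_cast; linarith) hc 1 0
  obtain ⟨b₃, hb₃, h₃⟩ := budget_one (k := 2) (j := 1) (κ₃ := κ₃) hθ0 (by push_cast; linarith) (by norm_num : (0 : ℝ) < 1 / 8) 252 0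
  obtain ⟨b₄, hb₄, h₄⟩ := exists_beta0_le_rpow hθ X
  refine ⟨max (max b₁ b₂) (max b₃ b₄), le_max_of_le_left (le_max_of_le_left hb₁), fun β hβ H hH hHl hHu => ?_⟩
  have hβ1 : b₁ ≤ β := (le_max_left _ _).trans ((le_max_left _ _).trans hβ)
  have hβ2 : b₂ ≤ β := (le_max_right _ _).trans ((le_max_left _ _).trans hβ)
  have hβ3 : b₃ ≤ β := (le_max_left _ _).trans ((le_max_right _ _).trans hβ)
  have hβ4 : b₄ ≤ β := (le_max_right _ _).trans ((le_max_right _ _).trans hβ)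
  have hβone : 1 ≤ β := hb₁.trans hβ1
  have hβpos : 0 < β := by linarith
  have hH1 : (1 : ℝ) ≤ H := by exact_mod_cast hH
  have hH2 : 0 < (H : ℝ) ^ 2 := by positivity
  have e₁ := h₁ β hβ1 H hH hHu
  have e₂ := h₂ β hβ2 H hH hHu
  have e₃ := h₃ β hβ3 H hH hHu
  simp only [pow_zero, mul_one, one_mul, pow_one] at e₁ e₂ e₃
  refine ⟨?_, ?_, ?_, (h₄ β hβ4).trans hHl, ?_⟩
  · rwa [div_le_one hβpos] at e₁
  · linarith [mul_comm ((H : ℝ) ^ 2) (β ^ (κ₃ - 1 / 2))]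
  · rw [lt_div_iff₀ hH2]
    linarith [mul_comm ((H : ℝ) ^ 2) (β ^ (κ₃ - 1 / 2))]
  · exact Real.rpow_le_one_of_one_le_of_nonpos hβone (by linarith)


/-! ## The K3 algebra (fcl-p3 g26's four `T`-products) -/

/-- **K3 algebra**: `β²·h⁸·(T₁ + T₂ + T₃ + T₄) ≤` twelve monomials (AM–GM with weight `s` on the cross terms, `√(C_U L^m) ≤ √C_U·L^m`). -/
theorem k3_expr_le {h L β s CE CO CU : ℝ} (m : ℕ) (hL : 1 ≤ L) (hβ : 0 < β) (hs : 0 < s) (hCU : 0 ≤ CU) :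
    β ^ 2 * h ^ 8 *
        (Real.sqrt CE * L ^ 2 / β ^ 2 * Real.sqrt (CU * L ^ m) * (h ^ 4 / β + h ^ 6 * s ^ 3 + h ^ 4 * s ^ 4) +
          Real.sqrt (Real.sqrt CE * L ^ 2 / β ^ 2 * (Real.sqrt CO * s ^ 3 / (β * Real.sqrt β))) * Real.sqrt (CU * L ^ m) *
            (h ^ 2 / Real.sqrt β + h ^ 6 * s ^ 3 + h ^ 4 * s ^ 4) +
          Real.sqrt (Real.sqrt CO * s ^ 3 / (β * Real.sqrt β) * (Real.sqrt CE * L ^ 2 / β ^ 2)) * Real.sqrt (CU * L ^ m) *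
            (h ^ 2 / Real.sqrt β + h ^ 6 * s ^ 3 + h ^ 4 * s ^ 4) +
          Real.sqrt CO * s ^ 3 / (β * Real.sqrt β) * Real.sqrt (CU * L ^ m) * (h ^ 4 / β + h ^ 6 * s ^ 3 + h ^ 4 * s ^ 4)) ≤
      Real.sqrt CU * L ^ m *
        (Real.sqrt CE * L ^ 2 * (h ^ 12 / β + h ^ 14 * s ^ 3 + h ^ 12 * s ^ 4) +
          (Real.sqrt CE * L ^ 2 * (h ^ 10 * s / Real.sqrt β + h ^ 14 * s ^ 4 + h ^ 12 * s ^ 5) +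
            Real.sqrt CO * (h ^ 10 * s ^ 2 + h ^ 14 * s ^ 5 * Real.sqrt β + h ^ 12 * s ^ 6 * Real.sqrt β)) +
          Real.sqrt CO * (h ^ 12 * s ^ 3 / Real.sqrt β + h ^ 14 * s ^ 6 * Real.sqrt β + h ^ 12 * s ^ 7 * Real.sqrt β)) := by
  have hq : 0 < Real.sqrt β := Real.sqrt_pos.2 hβ
  have hβq : β = Real.sqrt β ^ 2 := (Real.sq_sqrt hβ.le).symm
  set q := Real.sqrt β with hq_def
  set A := Real.sqrt CE * L ^ 2 / β ^ 2 with hA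
  set B := Real.sqrt CO * s ^ 3 / (β * q) with hB
  set R := Real.sqrt (CU * L ^ m) with hR
  set P₈ := h ^ 4 / β + h ^ 6 * s ^ 3 + h ^ 4 * s ^ 4 with hP₈
  set P₄ := h ^ 2 / q + h ^ 6 * s ^ 3 + h ^ 4 * s ^ 4 with hP₄
  have hL0 : 0 ≤ L := by linarith
  have hA0 : 0 ≤ A := by rw [hA]; positivity
  have hB0 : 0 ≤ B := by rw [hB]; positivity
  have hR0 : 0 ≤ R := Real.sqrt_nonneg _
  have hP₈0 : 0 ≤ P₈ := by rw [hP₈]; positivity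
  have hP₄0 : 0 ≤ P₄ := by rw [hP₄]; positivity
  -- AM–GM with weight `s` (inlined: `√(xy) ≤ (x+y)/2`)
  have hAB : Real.sqrt (A * B) ≤ (s * A + B / s) / 2 := by
    have : A * B = (s * A) * (B / s) := by field_simp
    rw [this, Real.sqrt_le_left (by positivity)]
    nlinarith [sq_nonneg (s * A - B / s)]
  have hBA : Real.sqrt (B * A) = Real.sqrt (A * B) := by rw [mul_comm]
  -- `R ≤ √C_U · L^m` (inlined: `√x ≤ x` for `1 ≤ x`)
  have hRle : R ≤ Real.sqrt CU * L ^ m := by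
    rw [hR, Real.sqrt_mul hCU]
    refine mul_le_mul_of_nonneg_left ?_ (Real.sqrt_nonneg _)
    have h1 : (1 : ℝ) ≤ L ^ m := one_le_pow₀ hL
    rw [Real.sqrt_le_left (by linarith)]
    nlinarith
  have hX : Real.sqrt (A * B) * R * P₄ ≤ (s * A + B / s) / 2 * R * P₄ :=
    mul_le_mul_of_nonneg_right (mul_le_mul_of_nonneg_right hAB hR0) hP₄0
  have hsum0 : 0 ≤ A * P₈ + (s * A + B / s) * P₄ + B * P₈ := by positivity
  have hb8 : 0 ≤ β ^ 2 * h ^ 8 := by positivity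
  rw [hBA]
  calc β ^ 2 * h ^ 8 * (A * R * P₈ + Real.sqrt (A * B) * R * P₄ + Real.sqrt (A * B) * R * P₄ + B * R * P₈)
      ≤ β ^ 2 * h ^ 8 * (A * R * P₈ + (s * A + B / s) / 2 * R * P₄ + (s * A + B / s) / 2 * R * P₄ + B * R * P₈) := by
        apply mul_le_mul_of_nonneg_left _ hb8; linarith
    _ = β ^ 2 * h ^ 8 * (R * (A * P₈ + (s * A + B / s) * P₄ + B * P₈)) := by ring
    _ ≤ β ^ 2 * h ^ 8 * (Real.sqrt CU * L ^ m * (A * P₈ + (s * A + B / s) * P₄ + B * P₈)) :=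
        mul_le_mul_of_nonneg_left (mul_le_mul_of_nonneg_right hRle hsum0) hb8
    _ = _ := by
        rw [hA, hB, hP₈, hP₄, hβq]
        field_simp

/-- **K3 budget** at the v13 point: for `0 < θ < 5/64`, `κ₃ = (1 + 16θ)/36` and any `ε > 0`, `C_E, C_O, C_U ≥ 0`, `m`:
`β²·H⁸·(T₁+T₂+T₃+T₄)(s := β^{κ₃−1/2}) ≤ ε` for `β ≥ β₀`, `1 ≤ H ≤ β^θ + 1`. -/
theorem k3_budget {θ κ₃ ε : ℝ} (hθ : 0 < θ) (hθu : θ < 5 / 64) (hκ : κ₃ = (1 + 16 * θ) / 36) (hε : 0 < ε) (CE CO : ℝ) {CU : ℝ}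
    (hCU : 0 ≤ CU) (m : ℕ) :
    ∃ β₀ : ℝ, 1 ≤ β₀ ∧ ∀ β : ℝ, β₀ ≤ β → ∀ H : ℕ, 1 ≤ H → (H : ℝ) ≤ β ^ θ + 1 →
      β ^ 2 * (H : ℝ) ^ 8 *
        (Real.sqrt CE * (1 + Real.log H) ^ 2 / β ^ 2 * Real.sqrt (CU * (1 + Real.log H) ^ m) *
              ((H : ℝ) ^ 4 / β + (H : ℝ) ^ 6 * (β ^ (κ₃ - 1 / 2)) ^ 3 + (H : ℝ) ^ 4 * (β ^ (κ₃ - 1 / 2)) ^ 4) +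
            Real.sqrt (Real.sqrt CE * (1 + Real.log H) ^ 2 / β ^ 2 * (Real.sqrt CO * (β ^ (κ₃ - 1 / 2)) ^ 3 / (β * Real.sqrt β))) *
                Real.sqrt (CU * (1 + Real.log H) ^ m) *
              ((H : ℝ) ^ 2 / Real.sqrt β + (H : ℝ) ^ 6 * (β ^ (κ₃ - 1 / 2)) ^ 3 + (H : ℝ) ^ 4 * (β ^ (κ₃ - 1 / 2)) ^ 4) +
            Real.sqrt (Real.sqrt CO * (β ^ (κ₃ - 1 / 2)) ^ 3 / (β * Real.sqrt β) * (Real.sqrt CE * (1 + Real.log H) ^ 2 / β ^ 2)) *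
                Real.sqrt (CU * (1 + Real.log H) ^ m) *
              ((H : ℝ) ^ 2 / Real.sqrt β + (H : ℝ) ^ 6 * (β ^ (κ₃ - 1 / 2)) ^ 3 + (H : ℝ) ^ 4 * (β ^ (κ₃ - 1 / 2)) ^ 4) +
            Real.sqrt CO * (β ^ (κ₃ - 1 / 2)) ^ 3 / (β * Real.sqrt β) * Real.sqrt (CU * (1 + Real.log H) ^ m) *
              ((H : ℝ) ^ 4 / β + (H : ℝ) ^ 6 * (β ^ (κ₃ - 1 / 2)) ^ 3 + (H : ℝ) ^ 4 * (β ^ (κ₃ - 1 / 2)) ^ 4)) ≤ ε := by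
  have hθ0 : 0 ≤ θ := hθ.le
  have hε' : 0 < ε / 12 := by positivity
  -- the twelve monomials
  obtain h₁ := budget_inv (k := 12) (j := 0) (κ₃ := κ₃) hθ0 (by rw [hκ]; push_cast; linarith) hε' (Real.sqrt CU * Real.sqrt CE) (m + 2)
  obtain h₂ := budget_one (k := 14) (j := 3) (κ₃ := κ₃) hθ0 (by rw [hκ]; push_cast; linarith) hε' (Real.sqrt CU * Real.sqrt CE) (m + 2)
  obtain h₃ := budget_one (k := 12) (j := 4) (κ₃ := κ₃) hθ0 (by rw [hκ]; push_cast; linarith) hε' (Real.sqrt CU * Real.sqrt CE) (m + 2)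
  obtain h₄ := budget_invSqrt (k := 10) (j := 1) (κ₃ := κ₃) hθ0 (by rw [hκ]; push_cast; linarith) hε' (Real.sqrt CU * Real.sqrt CE) (m + 2)
  obtain h₅ := budget_one (k := 14) (j := 4) (κ₃ := κ₃) hθ0 (by rw [hκ]; push_cast; linarith) hε' (Real.sqrt CU * Real.sqrt CE) (m + 2)
  obtain h₆ := budget_one (k := 12) (j := 5) (κ₃ := κ₃) hθ0 (by rw [hκ]; push_cast; linarith) hε' (Real.sqrt CU * Real.sqrt CE) (m + 2)
  obtain h₇ := budget_one (k := 10) (j := 2) (κ₃ := κ₃) hθ0 (by rw [hκ]; push_cast; linarith) hε' (Real.sqrt CU * Real.sqrt CO) m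
  obtain h₈ := budget_sqrt (k := 14) (j := 5) (κ₃ := κ₃) hθ0 (by rw [hκ]; push_cast; linarith) hε' (Real.sqrt CU * Real.sqrt CO) m
  obtain h₉ := budget_sqrt (k := 12) (j := 6) (κ₃ := κ₃) hθ0 (by rw [hκ]; push_cast; linarith) hε' (Real.sqrt CU * Real.sqrt CO) m
  obtain h₁₀ := budget_invSqrt (k := 12) (j := 3) (κ₃ := κ₃) hθ0 (by rw [hκ]; push_cast; linarith) hε' (Real.sqrt CU * Real.sqrt CO) m
  obtain h₁₁ := budget_sqrt (k := 14) (j := 6) (κ₃ := κ₃) hθ0 (by rw [hκ]; push_cast; linarith) hε' (Real.sqrt CU * Real.sqrt CO) m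
  obtain h₁₂ := budget_sqrt (k := 12) (j := 7) (κ₃ := κ₃) hθ0 (by rw [hκ]; push_cast; linarith) hε' (Real.sqrt CU * Real.sqrt CO) m
  obtain ⟨β₀, hβ₀, hall⟩ := exists_forall_and h₁ (exists_forall_and h₂ (exists_forall_and h₃ (exists_forall_and h₄ (exists_forall_and h₅
    (exists_forall_and h₆ (exists_forall_and h₇ (exists_forall_and h₈ (exists_forall_and h₉ (exists_forall_and h₁₀
    (exists_forall_and h₁₁ h₁₂))))))))))
  refine ⟨β₀, hβ₀, fun β hβ H hH hHβ => ?_⟩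
  obtain ⟨e₁, e₂, e₃, e₄, e₅, e₆, e₇, e₈, e₉, e₁₀, e₁₁, e₁₂⟩ := hall β hβ H
  replace e₁ := e₁ hH hHβ; replace e₂ := e₂ hH hHβ; replace e₃ := e₃ hH hHβ; replace e₄ := e₄ hH hHβ
  replace e₅ := e₅ hH hHβ; replace e₆ := e₆ hH hHβ; replace e₇ := e₇ hH hHβ; replace e₈ := e₈ hH hHβ
  replace e₉ := e₉ hH hHβ; replace e₁₀ := e₁₀ hH hHβ; replace e₁₁ := e₁₁ hH hHβ; replace e₁₂ := e₁₂ hH hHβ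
  have hβ1 : 1 ≤ β := hβ₀.trans hβ
  have hβpos : 0 < β := by linarith
  have hH1 : (1 : ℝ) ≤ H := by exact_mod_cast hH
  have hL : 1 ≤ 1 + Real.log (H : ℝ) := by linarith [Real.log_nonneg hH1]
  have hs : 0 < β ^ (κ₃ - 1 / 2) := Real.rpow_pos_of_pos hβpos _
  have hk3 := k3_expr_le (h := (H : ℝ)) (L := 1 + Real.log H) (β := β) (s := β ^ (κ₃ - 1 / 2)) (CE := CE) (CO := CO) m hL hβpos hs hCU
  refine hk3.trans ?_
  generalize β ^ (κ₃ - 1 / 2) = s at e₁ e₂ e₃ e₄ e₅ e₆ e₇ e₈ e₉ e₁₀ e₁₁ e₁₂ ⊢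
  generalize 1 + Real.log (H : ℝ) = L at e₁ e₂ e₃ e₄ e₅ e₆ e₇ e₈ e₉ e₁₀ e₁₁ e₁₂ ⊢
  have hid : Real.sqrt CU * L ^ m *
        (Real.sqrt CE * L ^ 2 * ((H : ℝ) ^ 12 / β + (H : ℝ) ^ 14 * s ^ 3 + (H : ℝ) ^ 12 * s ^ 4) +
          (Real.sqrt CE * L ^ 2 * ((H : ℝ) ^ 10 * s / Real.sqrt β + (H : ℝ) ^ 14 * s ^ 4 + (H : ℝ) ^ 12 * s ^ 5) +
            Real.sqrt CO * ((H : ℝ) ^ 10 * s ^ 2 + (H : ℝ) ^ 14 * s ^ 5 * Real.sqrt β + (H : ℝ) ^ 12 * s ^ 6 * Real.sqrt β)) +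
          Real.sqrt CO * ((H : ℝ) ^ 12 * s ^ 3 / Real.sqrt β + (H : ℝ) ^ 14 * s ^ 6 * Real.sqrt β + (H : ℝ) ^ 12 * s ^ 7 * Real.sqrt β)) =
      Real.sqrt CU * Real.sqrt CE * (H : ℝ) ^ 12 * L ^ (m + 2) * s ^ 0 / β +
        Real.sqrt CU * Real.sqrt CE * (H : ℝ) ^ 14 * L ^ (m + 2) * s ^ 3 +
        Real.sqrt CU * Real.sqrt CE * (H : ℝ) ^ 12 * L ^ (m + 2) * s ^ 4 +
        Real.sqrt CU * Real.sqrt CE * (H : ℝ) ^ 10 * L ^ (m + 2) * s ^ 1 / Real.sqrt β +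
        Real.sqrt CU * Real.sqrt CE * (H : ℝ) ^ 14 * L ^ (m + 2) * s ^ 4 +
        Real.sqrt CU * Real.sqrt CE * (H : ℝ) ^ 12 * L ^ (m + 2) * s ^ 5 +
        Real.sqrt CU * Real.sqrt CO * (H : ℝ) ^ 10 * L ^ m * s ^ 2 +
        Real.sqrt CU * Real.sqrt CO * (H : ℝ) ^ 14 * L ^ m * s ^ 5 * Real.sqrt β +
        Real.sqrt CU * Real.sqrt CO * (H : ℝ) ^ 12 * L ^ m * s ^ 6 * Real.sqrt β +
        Real.sqrt CU * Real.sqrt CO * (H : ℝ) ^ 12 * L ^ m * s ^ 3 / Real.sqrt β +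
        Real.sqrt CU * Real.sqrt CO * (H : ℝ) ^ 14 * L ^ m * s ^ 6 * Real.sqrt β +
        Real.sqrt CU * Real.sqrt CO * (H : ℝ) ^ 12 * L ^ m * s ^ 7 * Real.sqrt β := by
    ring
  rw [hid]
  linarith only [e₁, e₂, e₃, e₄, e₅, e₆, e₇, e₈, e₉, e₁₀, e₁₁, e₁₂]

/-! ## The K4 and 13f₀ budgets -/

/-- **K4 budget** (w5 g23's `abs_tiltCum4_muD_le_rpow` bound times `β²H⁸/2`): eventually `≤ ε` for `0 < θ < 5/64`, `κ₃ = (1+16θ)/36`. -/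
theorem k4_budget {θ κ₃ ε : ℝ} (hθ : 0 < θ) (hθu : θ < 5 / 64) (hκ : κ₃ = (1 + 16 * θ) / 36) (hε : 0 < ε) {C : ℝ} (m : ℕ) :
    ∃ β₀ : ℝ, 1 ≤ β₀ ∧ ∀ β : ℝ, β₀ ≤ β → ∀ H : ℕ, 1 ≤ H → (H : ℝ) ≤ β ^ θ + 1 →
      β ^ 2 * (H : ℝ) ^ 8 / 2 *
        (C * (1 + Real.log H) ^ m *
          (2 * ((H : ℝ) ^ 4 / β ^ 3) + 8 * ((H : ℝ) ^ 8 * β ^ (-4 + 4 * κ₃)) + 4 * ((H : ℝ) ^ 12 * β ^ (-5 + 10 * κ₃)))) ≤ ε := by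
  have hθ0 : 0 ≤ θ := hθ.le
  have hε' : 0 < ε / 3 := by positivity
  obtain h₁ := budget_inv (k := 12) (j := 0) (κ₃ := κ₃) hθ0 (by rw [hκ]; push_cast; linarith) hε' C m
  obtain h₂ := budget_monomial (a := -2 + 4 * κ₃) (k := 16) (j := 0) (κ₃ := κ₃) hθ0 (by rw [hκ]; push_cast; linarith) hε' (4 * C) m
  obtain h₃ := budget_monomial (a := -3 + 10 * κ₃) (k := 20) (j := 0) (κ₃ := κ₃) hθ0 (by rw [hκ]; push_cast; linarith) hε' (2 * C) m
  obtain ⟨β₀, hβ₀, hall⟩ := exists_forall_and h₁ (exists_forall_and h₂ h₃)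
  refine ⟨β₀, hβ₀, fun β hβ H hH hHβ => ?_⟩
  obtain ⟨e₁, e₂, e₃⟩ := hall β hβ H
  replace e₁ := e₁ hH hHβ; replace e₂ := e₂ hH hHβ; replace e₃ := e₃ hH hHβ
  have hβpos : 0 < β := by linarith
  simp only [pow_zero, mul_one] at e₁ e₂ e₃
  have i1 : β ^ 2 * (H : ℝ) ^ 8 / 2 * (C * (1 + Real.log H) ^ m * (2 * ((H : ℝ) ^ 4 / β ^ 3))) =
      C * (H : ℝ) ^ 12 * (1 + Real.log H) ^ m / β := by
    field_simp
  have i2 : β ^ 2 * (H : ℝ) ^ 8 / 2 * (C * (1 + Real.log H) ^ m * (8 * ((H : ℝ) ^ 8 * β ^ (-4 + 4 * κ₃)))) =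
      4 * C * (H : ℝ) ^ 16 * (1 + Real.log H) ^ m * β ^ (-2 + 4 * κ₃) := by
    have : β ^ (-2 + 4 * κ₃) = β ^ 2 * β ^ (-4 + 4 * κ₃) := by
      rw [← Real.rpow_natCast β 2, ← Real.rpow_add hβpos]; congr 1; push_cast; ring
    rw [this]; ring
  have i3 : β ^ 2 * (H : ℝ) ^ 8 / 2 * (C * (1 + Real.log H) ^ m * (4 * ((H : ℝ) ^ 12 * β ^ (-5 + 10 * κ₃)))) =
      2 * C * (H : ℝ) ^ 20 * (1 + Real.log H) ^ m * β ^ (-3 + 10 * κ₃) := by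
    have : β ^ (-3 + 10 * κ₃) = β ^ 2 * β ^ (-5 + 10 * κ₃) := by
      rw [← Real.rpow_natCast β 2, ← Real.rpow_add hβpos]; congr 1; push_cast; ring
    rw [this]; ring
  have hsplit : β ^ 2 * (H : ℝ) ^ 8 / 2 *
        (C * (1 + Real.log H) ^ m *
          (2 * ((H : ℝ) ^ 4 / β ^ 3) + 8 * ((H : ℝ) ^ 8 * β ^ (-4 + 4 * κ₃)) + 4 * ((H : ℝ) ^ 12 * β ^ (-5 + 10 * κ₃)))) =
      β ^ 2 * (H : ℝ) ^ 8 / 2 * (C * (1 + Real.log H) ^ m * (2 * ((H : ℝ) ^ 4 / β ^ 3))) +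
        β ^ 2 * (H : ℝ) ^ 8 / 2 * (C * (1 + Real.log H) ^ m * (8 * ((H : ℝ) ^ 8 * β ^ (-4 + 4 * κ₃)))) +
        β ^ 2 * (H : ℝ) ^ 8 / 2 * (C * (1 + Real.log H) ^ m * (4 * ((H : ℝ) ^ 12 * β ^ (-5 + 10 * κ₃)))) := by ring
  rw [hsplit, i1, i2, i3]
  linarith only [e₁, e₂, e₃]

/-- **13f₀ budget** (`96τβ² + C_f/β` with `τ ≤ C₆·H⁴·e^{−cβs²}`, times `H⁸`): eventually `≤ ε` for `0 ≤ θ`, `8θ < 1`, `κ₃ > 0`, `c > 0`. -/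
theorem f0_budget {θ κ₃ c ε : ℝ} (hθ : 0 ≤ θ) (h8 : 8 * θ < 1) (hκ₃ : 0 < κ₃) (hc : 0 < c) (hε : 0 < ε) (C₆ Cf : ℝ) :
    ∃ β₀ : ℝ, 1 ≤ β₀ ∧ ∀ β : ℝ, β₀ ≤ β → ∀ H : ℕ, 1 ≤ H → (H : ℝ) ≤ β ^ θ + 1 →
      (96 * (C₆ * (H : ℝ) ^ 4 * Real.exp (-(c * β * (β ^ (κ₃ - 1 / 2)) ^ 2))) * β ^ 2 + Cf / β) * (H : ℝ) ^ 8 ≤ ε := by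
  have hε' : 0 < ε / 2 := by positivity
  obtain h₁ := exists_forall_natPow_exp_le hθ (by positivity : 0 < 2 * κ₃) hc hε' (96 * C₆) 2 12
  obtain h₂ := budget_inv (k := 8) (j := 0) (κ₃ := κ₃) hθ (by push_cast; linarith) hε' Cf 0
  obtain ⟨β₀, hβ₀, hall⟩ := exists_forall_and h₁ h₂
  refine ⟨β₀, hβ₀, fun β hβ H hH hHβ => ?_⟩
  obtain ⟨e₁, e₂⟩ := hall β hβ H
  replace e₁ := e₁ hH hHβ; replace e₂ := e₂ hH hHβ
  have hβpos : 0 < β := by linarith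
  simp only [pow_zero, mul_one] at e₂
  have hβs : c * β * (β ^ (κ₃ - 1 / 2)) ^ 2 = c * β ^ (2 * κ₃) := by
    rw [rpow_pow_eq hβpos.le, mul_assoc, ← Real.rpow_one_add' hβpos.le (by push_cast; linarith)]
    congr 2; push_cast; ring
  have h2 : β ^ (2 : ℝ) = β ^ 2 := Real.rpow_natCast β 2 ▸ by norm_num
  rw [hβs]
  rw [h2] at e₁
  have hsplit : (96 * (C₆ * (H : ℝ) ^ 4 * Real.exp (-(c * β ^ (2 * κ₃)))) * β ^ 2 + Cf / β) * (H : ℝ) ^ 8 =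
      96 * C₆ * (H : ℝ) ^ 12 * β ^ 2 * Real.exp (-(c * β ^ (2 * κ₃))) + Cf * (H : ℝ) ^ 8 / β := by
    ring
  rw [hsplit]
  linarith only [e₁, e₂]

end AssemblyBudget

end Summit.QuantumFields.YangMills.Theorems.AllWindowsColdBoxBoxHighLine

end
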